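import Mathlib
import Literature.Analysis.FunctionSpaces.GaussianSchwartz

/-!
# Route OddMorawetz — vocabulary for exact Euler-derivative computations on polynomial-Gaussian fields

Route `OddMorawetz` (Theses file `Summits/NavierStokesRegularity/NavierStokesRegularity/Theses/OddMorawetz.lean`)
hunts for odd local functionals of 3-D Euler with a one-signed Euler derivative; its items are decided by EXACT
evaluation of quartic Euler-derivative forms `Q(v)` on explicit divergence-free Schwartz test fields
(`OrderThreeIndefinite`: the order-3 form `Q_R = -dR/dt`, `R = ∫ ω·Sω`, takes both signs; `OddMorawetzLocal`:
SOS / infeasibility certificates on explicit test fields).  This file fixes the shared vocabulary of those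
computations — polynomial × Gaussian vector fields on `ℝ³` with coefficients kept as `MvPolynomial (Fin 3) ℝ`, so
that every derivative, product and divergence is again an explicit polynomial and every integral is a Gaussian
moment:

* `pev p x` — evaluation of `p : MvPolynomial (Fin 3) ℝ` at `x : ℝ³`; `pg k p x = p(x) e^{-k|x|²}`;
  `dg k j p = ∂ⱼp - 2k xⱼ p`, the polynomial of `∂ⱼ (p e^{-k|x|²})`, and its iterate `dgList` along a list of
  coordinate directions; `Dpev p x` the derivative of `pev p` as a continuous linear map;
* `pgv k P` — the vector field with components `pg k (P i)`; `curlP k P` — the polynomials of its curl;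
* Schwartz packaging: `pgS k p : 𝓢(ℝ³, ℝ)`, `pgvS k P : 𝓢(ℝ³, ℝ³)`, `pgC k p : 𝓢(ℝ³, ℂ)` (multiplication of the tree's
  `realGaussianSchwartz` by the temperate polynomial), and iterated line derivatives `iterLD l f` of a Schwartz map;
* the bookkeeping of the order-3 form `Q_R(v) = -∫(⟪curl b, Dv ω⟫ + ⟪ω, Db ω⟫ + ⟪ω, Dv curl b⟫)`, `b = B(v,v)`,
  `ω = curl v`: the test vectors `psiVec A ω j` with `∑ⱼ ⟪Db eⱼ, Ψⱼ⟫ =` the integrand, and for `v = pgv 1 P` the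
  polynomials `AomP, AtomP, FP, psiP` (`Ψⱼ`), `WP` (`W = 2(v·∇)v`), `GP` (`G = ∑ⱼ∂ⱼΨⱼ`), `rhoWP = div W`,
  `rhoGP = div G` (weight `e^{-2|x|²}`) and `WGP = ⟪W, G⟫` (weight `e^{-4|x|²}`);
* list encodings of explicit numbers: `polyE` (even monomial lists), `pairs`, `hermVal` (paired Hermite lists on
  the Fourier side, `𝓕[∂^{2α} e^{-2|x|²}] = ∏(-4π²ξⱼ²)^{αⱼ} 𝓕[e^{-2|x|²}]`).

Design: plain `def`s over Mathlib notions (`MvPolynomial.eval`, `MvPolynomial.pderiv`, `EuclideanSpace.single`,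
`SchwartzMap.bilinLeftCLM`, `LineDeriv.lineDerivOp`) and the tree's `realGaussianSchwartz`
(`Literature/Analysis/FunctionSpaces/GaussianSchwartz.lean`); Gaussian rates are natural numbers `k` (the fields use
`k = 1`, quadratic quantities `k = 2`, quartic `k = 4`).  `pgS 0 p`, `pgvS 0 P`, `pgC 0 p` are the junk value `0`
(inherited from `realGaussianSchwartz` at rate `0`); all uses have `k ≥ 1`.  Only the small algebra needed to state
the definitions is proved here (`pev` is a ring homomorphism pointwise; temperate growth of `pev p`); the calculus,
the Fourier side and the computations live in the `OddMorawetzOrderThreeIndefinite*` theorem files.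
Nothing here restates a tree notion (`lean search` 2026-08-16: no `MvPolynomial`-based Gaussian field vocabulary in
`Literature` or `Summits`).
-/

noncomputable section

open MeasureTheory SchwartzMap MvPolynomial
open scoped RealInnerProductSpace LineDeriv

-- the problem namespace `Summit.NavierStokesRegularity.NavierStokesRegularity` repeats the summit name by design (D-0017)
set_option linter.dupNamespace false

namespace Summit.NavierStokesRegularity.NavierStokesRegularity.Theorems.OddMorawetz

/-- Physical / frequency space `ℝ³`. -/
abbrev E3 := EuclideanSpace ℝ (Fin 3)
/-- Real polynomials in the three coordinates. -/
abbrev P3 := MvPolynomial (Fin 3) ℝ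

/-! ### Polynomial Gaussians -/

/-- Evaluation of a polynomial at a point of `ℝ³`: `pev p x = p(x₀, x₁, x₂)`. -/
def pev (p : P3) (x : E3) : ℝ := MvPolynomial.eval (fun i => x i) p

/-- The polynomial Gaussian `x ↦ p(x) e^{-k|x|²}`. -/
def pg (k : ℕ) (p : P3) (x : E3) : ℝ := pev p x * Real.exp (-(k : ℝ) * ‖x‖ ^ 2)

/-- The Gaussian-conjugated partial derivative on polynomials: `∂ⱼ (p e^{-k|x|²}) = (dg k j p) e^{-k|x|²}`,
`dg k j p = ∂ⱼ p - 2k xⱼ p`. -/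
def dg (k : ℕ) (j : Fin 3) (p : P3) : P3 := pderiv j p - 2 * (k : P3) * X j * p

/-- Iterated conjugated derivatives along a list of coordinate directions (outermost first):
`dgList k [j₁, j₂, …] p = dg k j₁ (dg k j₂ (… p))`. -/
def dgList (k : ℕ) (l : List (Fin 3)) (p : P3) : P3 := l.foldr (dg k) p

/-- The polynomial-Gaussian vector field with components `pg k (P i)`. -/
def pgv (k : ℕ) (P : Fin 3 → P3) (x : E3) : E3 := ∑ i, pg k (P i) x • EuclideanSpace.single i (1 : ℝ)

/-- The polynomials of `curl (pgv k P)` (components `(∂₁v₂ - ∂₂v₁, ∂₂v₀ - ∂₀v₂, ∂₀v₁ - ∂₁v₀)`, the tree's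
`Literature.Analysis.FluidPDE.curl`). -/
def curlP (k : ℕ) (P : Fin 3 → P3) : Fin 3 → P3 :=
  ![dg k 1 (P 2) - dg k 2 (P 1), dg k 2 (P 0) - dg k 0 (P 2), dg k 0 (P 1) - dg k 1 (P 0)]

/-- The derivative of `pev p` at `x`, as a continuous linear map: `w ↦ ∑ⱼ (∂ⱼp)(x) wⱼ`. -/
def Dpev (p : P3) (x : E3) : E3 →L[ℝ] ℝ :=
  ∑ j : Fin 3, pev (pderiv j p) x • (EuclideanSpace.proj (𝕜 := ℝ) j : E3 →L[ℝ] ℝ)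

/-! ### `pev` is a ring homomorphism (pointwise) -/

/-- `pev (C a) x = a`. -/
@[simp] theorem pev_C (a : ℝ) (x : E3) : pev (C a) x = a := by simp [pev]
/-- `pev (X i) x = xᵢ`. -/
@[simp] theorem pev_X (i : Fin 3) (x : E3) : pev (X i) x = x i := by simp [pev]
/-- `pev` is additive. -/
@[simp] theorem pev_add (p q : P3) (x : E3) : pev (p + q) x = pev p x + pev q x := by simp [pev]
/-- `pev` is multiplicative. -/
@[simp] theorem pev_mul (p q : P3) (x : E3) : pev (p * q) x = pev p x * pev q x := by simp [pev]
/-- `pev` respects subtraction. -/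
@[simp] theorem pev_sub (p q : P3) (x : E3) : pev (p - q) x = pev p x - pev q x := by simp [pev]
/-- `pev` respects negation. -/
@[simp] theorem pev_neg (p : P3) (x : E3) : pev (-p) x = -pev p x := by simp [pev]
/-- `pev` respects powers. -/
@[simp] theorem pev_pow (p : P3) (n : ℕ) (x : E3) : pev (p ^ n) x = pev p x ^ n := by simp [pev]
/-- `pev` of a natural-number cast. -/
@[simp] theorem pev_natCast (n : ℕ) (x : E3) : pev (n : P3) x = n := by simp [pev]
/-- `pev` of a numeral. -/
@[simp] theorem pev_ofNat (n : ℕ) [n.AtLeastTwo] (x : E3) :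
    pev (no_index (OfNat.ofNat n : P3)) x = OfNat.ofNat n := by simp [pev]
/-- `pev 1 x = 1`. -/
@[simp] theorem pev_one (x : E3) : pev 1 x = 1 := by simp [pev]
/-- `pev 0 x = 0`. -/
@[simp] theorem pev_zero (x : E3) : pev 0 x = 0 := by simp [pev]
/-- `pev` of a real scalar multiple. -/
@[simp] theorem pev_smul (c : ℝ) (p : P3) (x : E3) : pev (c • p) x = c * pev p x := by
  simp [pev, smul_eval]
/-- partial derivatives kill numerals. -/
@[simp] theorem pderiv_ofNat' (i : Fin 3) (n : ℕ) [n.AtLeastTwo] :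
    pderiv i (no_index (OfNat.ofNat n : P3)) = 0 := Derivation.map_natCast _ n
/-- partial derivatives kill natural-number casts. -/
@[simp] theorem pderiv_natCast' (i : Fin 3) (n : ℕ) : pderiv i (n : P3) = 0 := Derivation.map_natCast _ n

/-- coordinates have temperate growth. -/
theorem hasTemperateGrowth_coord (n : Fin 3) : Function.HasTemperateGrowth (fun y : E3 => y n) :=
  (EuclideanSpace.proj (𝕜 := ℝ) n).hasTemperateGrowth

/-- **polynomials have temperate growth** (induction on the polynomial). -/
theorem pev_hasTemperateGrowth (p : P3) : Function.HasTemperateGrowth (pev p) := by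
  induction p using MvPolynomial.induction_on with
  | C a =>
    have e : (fun _ : E3 => a) = pev (C a) := by funext y; exact (pev_C a y).symm
    exact e ▸ Function.HasTemperateGrowth.const a
  | add p q hp hq =>
    have e : pev p + pev q = pev (p + q) := by funext y; exact (pev_add p q y).symm
    exact e ▸ hp.add hq
  | mul_X p n hp =>
    have e : (pev p * fun y : E3 => y n) = pev (p * X n) := by
      funext y; simp only [Pi.mul_apply, pev_mul, pev_X]
    exact e ▸ hp.mul (hasTemperateGrowth_coord n)

/-! ### Schwartz packaging -/

/-- `p e^{-k|x|²}` as a real Schwartz function: the tree's Gaussian Schwartz function `realGaussianSchwartz E3 k`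
multiplied by the temperate polynomial `pev p` (`SchwartzMap.bilinLeftCLM`).  Junk value `0` for `k = 0`. -/
def pgS (k : ℕ) (p : P3) : 𝓢(E3, ℝ) :=
  SchwartzMap.bilinLeftCLM (ContinuousLinearMap.mul ℝ ℝ) (pev_hasTemperateGrowth p)
    (Literature.Analysis.FunctionSpaces.realGaussianSchwartz E3 (k : ℝ))

/-- The vector field `pgv k P` as a Schwartz map `ℝ³ → ℝ³` (junk `0` for `k = 0`). -/
def pgvS (k : ℕ) (P : Fin 3 → P3) : 𝓢(E3, E3) :=
  ∑ i, SchwartzMap.postcompCLM (𝕜 := ℝ)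
    (ContinuousLinearMap.toSpanSingleton ℝ (EuclideanSpace.single i (1 : ℝ))) (pgS k (P i))

/-- `(p e^{-k|x|²} : ℂ)` as a complex-valued Schwartz function (junk `0` for `k = 0`). -/
def pgC (k : ℕ) (p : P3) : 𝓢(E3, ℂ) :=
  SchwartzMap.postcompCLM (𝕜 := ℝ) Complex.ofRealCLM (pgS k p)

/-- Iterated line derivatives of a complex Schwartz function along a list of coordinate directions
(outermost first): `iterLD [j₁, j₂, …] f = ∂_{e_{j₁}} (∂_{e_{j₂}} (… f))`. -/
def iterLD (l : List (Fin 3)) (f : 𝓢(E3, ℂ)) : 𝓢(E3, ℂ) :=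
  l.foldr (fun j g => ∂_{EuclideanSpace.single j (1 : ℝ)} g) f

/-! ### Bookkeeping of the order-3 form `Q_R` -/

/-- The test vectors `Ψⱼ(A, ω)` of the order-3 computation: with `Fᵢ = (Aω)ᵢ + ⟪A eᵢ, ω⟫` (`F = Aω + Aᵀω`),
`Ψ₀ = (0, F₂, -F₁) + ω₀ ω`, `Ψ₁ = (-F₂, 0, F₀) + ω₁ ω`, `Ψ₂ = (F₁, -F₀, 0) + ω₂ ω`; they satisfy
`⟪curl b, A ω⟫ + ⟪ω, (Db) ω⟫ + ⟪ω, A curl b⟫ = ∑ⱼ ⟪(Db) eⱼ, Ψⱼ⟫` for every `Db` (`curl b` read off `Db`). -/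
def psiVec (A : E3 →L[ℝ] E3) (ω : E3) (j : Fin 3) : E3 :=
  ![(WithLp.toLp 2 ![0, A ω 2 + ⟪A (EuclideanSpace.single 2 (1 : ℝ)), ω⟫,
      -(A ω 1 + ⟪A (EuclideanSpace.single 1 (1 : ℝ)), ω⟫)] : E3) + ω 0 • ω,
    (WithLp.toLp 2 ![-(A ω 2 + ⟪A (EuclideanSpace.single 2 (1 : ℝ)), ω⟫), 0,
      A ω 0 + ⟪A (EuclideanSpace.single 0 (1 : ℝ)), ω⟫] : E3) + ω 1 • ω,
    (WithLp.toLp 2 ![A ω 1 + ⟪A (EuclideanSpace.single 1 (1 : ℝ)), ω⟫,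
      -(A ω 0 + ⟪A (EuclideanSpace.single 0 (1 : ℝ)), ω⟫), 0] : E3) + ω 2 • ω] j

/-- `(A ω)ᵢ` as a polynomial, for `v = pgv 1 P`, `A = Dv`, `ω = curl v` (Gaussian weight `e^{-2|x|²}`). -/
def AomP (P : Fin 3 → P3) (i : Fin 3) : P3 := ∑ j, curlP 1 P j * dg 1 j (P i)
/-- `⟪A eᵢ, ω⟫ = (Aᵀ ω)ᵢ` as a polynomial (weight `e^{-2|x|²}`). -/
def AtomP (P : Fin 3 → P3) (i : Fin 3) : P3 := ∑ j, dg 1 i (P j) * curlP 1 P j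
/-- `Fᵢ = (Aω)ᵢ + (Aᵀω)ᵢ` as a polynomial (weight `e^{-2|x|²}`). -/
def FP (P : Fin 3 → P3) (i : Fin 3) : P3 := AomP P i + AtomP P i
/-- The test fields `Ψⱼ` of `v = pgv 1 P` as polynomial vectors (weight `e^{-2|x|²}`), cf. `psiVec`. -/
def psiP (P : Fin 3 → P3) (j : Fin 3) : Fin 3 → P3 :=
  ![![0, FP P 2, -FP P 1] + fun i => curlP 1 P 0 * curlP 1 P i,
    ![-FP P 2, 0, FP P 0] + fun i => curlP 1 P 1 * curlP 1 P i,
    ![FP P 1, -FP P 0, 0] + fun i => curlP 1 P 2 * curlP 1 P i] j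
/-- `W = 2 (v·∇)v` as a polynomial vector (weight `e^{-2|x|²}`). -/
def WP (P : Fin 3 → P3) (i : Fin 3) : P3 := 2 * ∑ j, P j * dg 1 j (P i)
/-- `G = ∑ⱼ ∂ⱼ Ψⱼ` as a polynomial vector (weight `e^{-2|x|²}`). -/
def GP (P : Fin 3 → P3) (i : Fin 3) : P3 := ∑ j, dg 2 j (psiP P j i)
/-- `div W` as a polynomial (weight `e^{-2|x|²}`). -/
def rhoWP (P : Fin 3 → P3) : P3 := ∑ i, dg 2 i (WP P i)
/-- `div G` as a polynomial (weight `e^{-2|x|²}`). -/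
def rhoGP (P : Fin 3 → P3) : P3 := ∑ i, dg 2 i (GP P i)
/-- `⟪W, G⟫` as a polynomial (weight `e^{-4|x|²}`). -/
def WGP (P : Fin 3 → P3) : P3 := ∑ i, WP P i * GP P i

/-! ### List encodings of explicit numbers -/

/-- An even polynomial function on `ℝ³` given by a list of (coefficient, half-exponents):
`polyE L x = ∑_{(c,a,b,d) ∈ L} c x₀^{2a} x₁^{2b} x₂^{2d}`. -/
def polyE (L : List (ℝ × ℕ × ℕ × ℕ)) (x : E3) : ℝ :=
  (L.map fun t => t.1 * (x 0 ^ (2 * t.2.1) * x 1 ^ (2 * t.2.2.1) * x 2 ^ (2 * t.2.2.2))).sum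

/-- Doubling a list of directions: `pairs [j₁, j₂, …] = [j₁, j₁, j₂, j₂, …]` (even-order Hermite elements). -/
def pairs (ps : List (Fin 3)) : List (Fin 3) := ps.flatMap fun j => [j, j]

/-- The real Fourier-side value of a paired Hermite list: `hermVal L ξ = ∑_{(d, ps) ∈ L} d ∏_{j ∈ ps} (-4π² ξⱼ²)`,
so that `𝓕[(∑ d D^{pairs ps} 1) e^{-2|x|²}](ξ) = hermVal L ξ · 𝓕[e^{-2|x|²}](ξ)`. -/
def hermVal (L : List (ℝ × List (Fin 3))) (ξ : E3) : ℝ :=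
  (L.map fun dl => dl.1 * (dl.2.map fun j => -(4 * Real.pi ^ 2 * ξ j ^ 2)).prod).sum

end Summit.NavierStokesRegularity.NavierStokesRegularity.Theorems.OddMorawetz
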